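import Literature.Analysis.FunctionSpaces.TorusMollifiedFieldFourierBounds
import Literature.Analysis.FunctionSpaces.TorusMollifiedFields
import Literature.Analysis.FunctionSpaces.TorusSpectralWeakDerivative
import HarnessLib

/-!
# Mollification does not increase the spectral gradient norm

Analysis/FunctionSpaces support file (everything proved). The convolution theorem on `T^d` for an
*integrable* (not necessarily continuous) factor, and its consequence for the componentwise
mollification `vecMollify ε u` of an integrable vector field `u`:

* `Torus.mFourierCoeff_convolution_of_integrable` — `𝓕(θ ⋆ w)(k) = θ̂(k) ŵ(k)` for a continuous
  real kernel `θ` and an integrable complex `w` (Grafakos 2014, Prop. 3.1.2 (9); Fubini);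
* `Torus.mFourierCoeff_ofReal_convolution_kernel` — `𝓕(f ⋆ ρ)(k) = f̂(k) ρ̂(k)` for integrable
  real `f` and a continuous real kernel `ρ` (the tree's convention `f ⋆ k_ε`);
* `Torus.eGradNormSq_vecMollify_le` — **`‖∇(u ⋆ k_ε)‖²_{L²} ≤ ‖∇u‖²_{L²}`** for the spectral
  `Torus.eGradNormSq` and integrable `u` (`|k̂_ε| ≤ 1` termwise in `4π² ∑ |k|² ‖û(k)‖²`);
* `Torus.tendsto_eLpNorm_vecMollify_sub` — `u ⋆ k_{εₙ} → u` in `L²` for `u ∈ L²`,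
  componentwise from the scalar statement.

These serve the approximation of `L² ∩ Ḣ¹` drifts by smooth ones in Seis 2022, Lemma 3.

## References

* L. Grafakos, *Classical Fourier Analysis*, 3rd ed. (2014), Prop. 3.1.2 (9). [`Grafakos2014`]
* C. Seis, Comm. Math. Phys. 2022 (arXiv:2003.08794), Lemma 3. [`Seis2022`]
-/

noncomputable section

open MeasureTheory Set Filter Topology UnitAddTorus Function Metric ContinuousLinearMap
open scoped ENNReal NNReal Convolution ComplexConjugate

namespace Literature.Analysis.FunctionSpaces

namespace Torus

variable {d : Type*} [Fintype d]

/-! ## The convolution theorem with an integrable factor -/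

/-- **Convolution theorem on `T^d` with an integrable factor** (Grafakos 2014, Prop. 3.1.2 (9)):
for a continuous real kernel `θ` and an integrable complex `w`, `𝓕(θ ⋆ w)(k) = 𝓕θ(k) 𝓕w(k)`
(Fubini on `T^d × T^d`, the integrand `e₋ₖ(x) θ(y) w(x - y)` being integrable because
`θ` is bounded and `w ∈ L¹`). [cite: Grafakos2014, Prop. 3.1.2 (9)] -/
theorem mFourierCoeff_convolution_of_integrable {θ : UnitAddTorus d → ℝ} (hθ : Continuous θ)
    {w : UnitAddTorus d → ℂ} (hw : Integrable w volume) (k : d → ℤ) :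
    mFourierCoeff (θ ⋆ w) k = mFourierCoeff (fun x => (θ x : ℂ)) k * mFourierCoeff w k := by
  simp only [mFourierCoeff_eq_integral_conj_mul]
  set Φ : UnitAddTorus d → UnitAddTorus d → ℂ :=
    fun x y => conj (mFourier k x) * ((θ y : ℂ) * w (x - y)) with hΦ_def
  -- integrability on the product
  have hconv : Integrable (fun p : UnitAddTorus d × UnitAddTorus d => (θ p.2 : ℂ) * w (p.1 - p.2))
      ((volume : Measure (UnitAddTorus d)).prod volume) := by
    have h1 := (hθ.integrable_unitAddTorus (d := d)).convolution_integrand (lsmul ℝ ℝ) hw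
    refine h1.congr (Eventually.of_forall fun p => ?_)
    simp only [lsmul_apply, Complex.real_smul]
  have hchar : Continuous fun p : UnitAddTorus d × UnitAddTorus d => conj (mFourier k p.1) := by fun_prop
  have hΦi : Integrable (uncurry Φ) ((volume : Measure (UnitAddTorus d)).prod volume) :=
    hconv.bdd_mul (c := 1) hchar.aestronglyMeasurable (Eventually.of_forall fun p => by
      rw [RCLike.norm_conj]
      exact ((mFourier k).norm_coe_le_norm p.1).trans_eq mFourier_norm)
  calc ∫ x, conj (mFourier k x) * (θ ⋆ w) x
      = ∫ x, ∫ y, Φ x y := by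
        refine integral_congr_ae (ae_of_all _ fun x => ?_)
        simp only [hΦ_def, convolution_lsmul, Complex.real_smul, ← integral_const_mul]
    _ = ∫ y, ∫ x, Φ x y := integral_integral_swap hΦi
    _ = ∫ y, conj (mFourier k y) * (θ y : ℂ) * ∫ x, conj (mFourier k x) * w x := by
        refine integral_congr_ae (ae_of_all _ fun y => ?_)
        beta_reduce
        have h1 : ∫ x, Φ x y = ∫ x, Φ (x + y) y := (integral_add_right_eq_self (fun x => Φ x y) y).symm
        rw [h1, ← integral_const_mul]
        refine integral_congr_ae (ae_of_all _ fun x => ?_)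
        simp only [hΦ_def, add_sub_cancel_right, mFourier_apply_add, map_mul]
        ring
    _ = (∫ y, conj (mFourier k y) * (θ y : ℂ)) * ∫ x, conj (mFourier k x) * w x :=
        integral_mul_const _ _

/-- **Convolution theorem for `f ⋆ ρ` with integrable real `f` and a continuous real kernel `ρ`**
(the tree's mollification convention): `𝓕(f ⋆ ρ)(k) = f̂(k) ρ̂(k)`. [folklore] -/
theorem mFourierCoeff_ofReal_convolution_kernel {f ρ : UnitAddTorus d → ℝ} (hf : Integrable f volume)
    (hρ : Continuous ρ) (k : d → ℤ) :
    mFourierCoeff (fun x => ((f ⋆ ρ) x : ℂ)) k =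
      mFourierCoeff (fun x => (f x : ℂ)) k * mFourierCoeff (fun x => (ρ x : ℂ)) k := by
  have hfun : (fun x => (((f ⋆ ρ) x : ℝ) : ℂ)) = ρ ⋆ fun y => (f y : ℂ) := by
    funext x
    rw [convolution_comm_real f ρ, ofReal_convolution]
  rw [hfun]
  exact (mFourierCoeff_convolution_of_integrable hρ hf.ofReal k).trans (mul_comm _ _)

/-! ## The spectral gradient norm of a mollified field -/

/-- The mollified field of an integrable field is integrable. [folklore] -/
theorem integrable_vecMollify {u : UnitAddTorus d → EuclideanSpace ℝ d} (hu : Integrable u volume)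
    {ε : ℝ} (hε : 0 < ε) (hε' : ε ≤ 1 / 4) : Integrable (vecMollify ε u) volume :=
  (isSmooth_vecMollify hu hε hε').integrable

/-- Fourier coefficients of the mollified field: `(𝓕(u ⋆ k_ε)(k))ᵢ = k̂_ε(k) ûᵢ(k)`. [folklore] -/
theorem mFourierCoeff_complexify_vecMollify_apply {u : UnitAddTorus d → EuclideanSpace ℝ d}
    (hu : Integrable u volume) {ε : ℝ} (hε : 0 < ε) (hε' : ε ≤ 1 / 4) (k : d → ℤ) (i : d) :
    mFourierCoeff (EuclideanSpace.complexify ∘ vecMollify ε u) k i =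
      mFourierCoeff (fun x => (kernel ε x : ℂ)) k * mFourierCoeff (EuclideanSpace.complexify ∘ u) k i := by
  rw [mFourierCoeff_complexify_apply (integrable_vecMollify hu hε hε') k i,
    mFourierCoeff_complexify_apply hu k i]
  simp only [vecMollify_apply]
  rw [mFourierCoeff_ofReal_convolution_kernel (hu.eval_piLp i) (continuous_kernel hε hε') k, mul_comm]

/-- **Mollification does not increase the spectral gradient norm**:
`eGradNormSq (vecMollify ε u) ≤ eGradNormSq u` for integrable `u` and `0 < ε ≤ 1/4`
(`|k̂_ε(k)| ≤ 1` termwise in `4π² ∑ₖ |k|² ‖û(k)‖²`). [folklore] -/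
theorem eGradNormSq_vecMollify_le {u : UnitAddTorus d → EuclideanSpace ℝ d} (hu : Integrable u volume)
    {ε : ℝ} (hε : 0 < ε) (hε' : ε ≤ 1 / 4) : eGradNormSq (vecMollify ε u) ≤ eGradNormSq u := by
  rw [eGradNormSq_eq_tsum, eGradNormSq_eq_tsum]
  refine mul_le_mul' le_rfl (ENNReal.tsum_le_tsum fun k => mul_le_mul' le_rfl ?_)
  rw [enorm_sq_eq_sum_euclidean, enorm_sq_eq_sum_euclidean]
  refine Finset.sum_le_sum fun i _ => ?_
  rw [mFourierCoeff_complexify_vecMollify_apply hu hε hε' k i, enorm_mul, mul_pow]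
  have h1 : ‖mFourierCoeff (fun x => (kernel ε x : ℂ)) k‖ₑ ≤ 1 := by
    rw [← ofReal_norm, ← ENNReal.ofReal_one]
    exact ENNReal.ofReal_le_ofReal (norm_mFourierCoeff_ofReal_le_one (continuous_kernel hε hε')
      (fun y => kernel_nonneg hε.le y) (integral_kernel hε hε') k)
  calc ‖mFourierCoeff (fun x => (kernel ε x : ℂ)) k‖ₑ ^ 2 * ‖mFourierCoeff (EuclideanSpace.complexify ∘ u) k i‖ₑ ^ 2
      ≤ 1 ^ 2 * ‖mFourierCoeff (EuclideanSpace.complexify ∘ u) k i‖ₑ ^ 2 := by gcongr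
    _ = _ := by rw [one_pow, one_mul]

/-! ## `L²` convergence of the mollified field -/

/-- `‖w‖ ≤ ∑ᵢ |wᵢ|` in `ℝ^d`. [folklore] -/
theorem norm_le_sum_abs_coord [DecidableEq d] (w : EuclideanSpace ℝ d) : ‖w‖ ≤ ∑ i, |w i| := by
  have h : w = ∑ i, (w i) • EuclideanSpace.single i (1 : ℝ) := by
    ext j
    simp [Finset.sum_apply, Pi.single_apply]
  calc ‖w‖ = ‖∑ i, (w i) • EuclideanSpace.single i (1 : ℝ)‖ := by rw [← h]
    _ ≤ ∑ i, ‖(w i) • EuclideanSpace.single i (1 : ℝ)‖ := norm_sum_le _ _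
    _ = ∑ i, |w i| := Finset.sum_congr rfl fun i _ => by
        rw [norm_smul, PiLp.norm_single, norm_one, mul_one, Real.norm_eq_abs]

/-- **`L²` convergence of the mollified field**: `‖vecMollify εₙ u - u‖_{L²} → 0` for `u ∈ L²`
and radii `εₙ → 0` (`0 < εₙ ≤ 1/4`), componentwise from the scalar
`Torus.tendsto_eLpNorm_convolution_sub_self`. [folklore] -/
theorem tendsto_eLpNorm_vecMollify_sub {u : UnitAddTorus d → EuclideanSpace ℝ d} (hu : MemLp u 2 volume)
    {ε : ℕ → ℝ} (hε : ∀ n, 0 < ε n) (hε' : ∀ n, ε n ≤ 1 / 4) (hε0 : Tendsto ε atTop (𝓝 0)) :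
    Tendsto (fun n => eLpNorm (vecMollify (ε n) u - u) 2 volume) atTop (𝓝 0) := by
  classical
  have hui : Integrable u volume := hu.integrable one_le_two
  -- componentwise convergence
  have hcomp : ∀ i, Tendsto (fun n => eLpNorm ((fun y => u y i) ⋆ kernel (ε n) - fun y => u y i) 2 volume)
      atTop (𝓝 0) := fun i =>
    tendsto_eLpNorm_convolution_sub_self (hu.eval_piLp i) (fun n y => kernel_nonneg (hε n).le y)
      (fun n => integral_kernel (hε n) (hε' n)) (fun n => support_kernel_subset (hε n))
      (fun n => continuous_kernel (hε n) (hε' n)) hε0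
  have hsum : Tendsto (fun n => ∑ i, eLpNorm ((fun y => u y i) ⋆ kernel (ε n) - fun y => u y i) 2 volume)
      atTop (𝓝 0) := by
    have := tendsto_finsetSum (Finset.univ : Finset d) fun i _ => hcomp i
    rwa [Finset.sum_const_zero] at this
  refine tendsto_of_tendsto_of_tendsto_of_le_of_le tendsto_const_nhds hsum (fun n => bot_le) fun n => ?_
  -- `‖vecMollify - u‖_{L²} ≤ ∑ᵢ ‖uᵢ ⋆ k - uᵢ‖_{L²}`
  have hmeas : ∀ i, AEStronglyMeasurable ((fun y => u y i) ⋆ kernel (ε n) - fun y => u y i) volume := fun i =>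
    (continuous_convolution (hui.eval_piLp i) (continuous_kernel (hε n) (hε' n))).aestronglyMeasurable.sub
      (hu.eval_piLp i).1
  have hpt : ∀ x, ‖(vecMollify (ε n) u - u) x‖ ≤
      ‖∑ i, |((fun y => u y i) ⋆ kernel (ε n) - fun y => u y i) x|‖ := by
    intro x
    rw [Real.norm_eq_abs, abs_of_nonneg (Finset.sum_nonneg fun i _ => abs_nonneg _)]
    refine (norm_le_sum_abs_coord _).trans (le_of_eq (Finset.sum_congr rfl fun i _ => ?_))
    simp [vecMollify_apply]
  refine (eLpNorm_mono hpt).trans ?_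
  have hmeas' : ∀ i ∈ (Finset.univ : Finset d), AEStronglyMeasurable
      (fun x => |((fun y => u y i) ⋆ kernel (ε n) - fun y => u y i) x|) volume := fun i _ =>
    (hmeas i).norm.congr (Eventually.of_forall fun x => Real.norm_eq_abs _)
  have e : (fun x => ∑ i, |((fun y => u y i) ⋆ kernel (ε n) - fun y => u y i) x|) =
      ∑ i, fun x => |((fun y => u y i) ⋆ kernel (ε n) - fun y => u y i) x| := by
    funext x
    simp [Finset.sum_apply]
  rw [e]
  refine (eLpNorm_sum_le hmeas' one_le_two).trans (Finset.sum_le_sum fun i _ => le_of_eq ?_)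
  exact eLpNorm_congr_norm_ae (Eventually.of_forall fun x => by rw [Real.norm_eq_abs, abs_abs, Real.norm_eq_abs])

end Torus

end Literature.Analysis.FunctionSpaces
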